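import Summits.CriticalPhenomena.PercolationContinuityZ3.Theorems.PercNearOneGluingNoHeavyQuantTreeBuiltCells
import Summits.CriticalPhenomena.PercolationContinuityZ3.Theorems.PercNearOneGluingNoHeavyQuantSingleGateClosure
import Summits.CriticalPhenomena.PercolationContinuityZ3.Theorems.PercNearOneGluingNoHeavyQuantGateMoveBlob
import Summits.CriticalPhenomena.PercolationContinuityZ3.Theorems.PercNearOneGluingNoHeavyQuantSDECBlobs
import Summits.CriticalPhenomena.PercolationContinuityZ3.Theorems.PercNearOneGluingNoHeavyQuantGatedConvSplit
import Summits.CriticalPhenomena.PercolationContinuityZ3.Theorems.PercNearOneGluingNoHeavyQuantGateCouplingMixture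
import HarnessLib

/-!
# QUANT lane R8, T-DEC: THE ROOT-GATE STEP — the conv/gate step of the SDEC tree induction may assume that the second factor is ONE
# TREE `gate_g c` AND that the product with its UNGATED sub-forest `c` is already SDEC; `RootGateStep ⟹ SDECConvClosedTB ⟹ FarTreeRow`

builds on p205010 (kernel theorem, internal audit signed; external expert review pending)

Statement + support file (`--supports stmt-CriticalPhenomena-4575`), QUANT lane lead seat prim-quant-lead (gen 42), rung R8 of
`run/shared/lean/prim/quant/LADDER.md`.  One `@[conjecture]` (`LawDec.RootGateStep`), one auxiliary `Prop` (`LawDec.SDECRightFactor`),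
theorems with standard axioms, no sorries.  Continues census-2 g53's `…QuantSDEC` (`SDEC`, `TreeBuilt`, `treeBuilt_sdec`), typer g31/g32's
`…QuantTreeBuiltCells` (`SDECConvClosedTB`, `farTreeRow_of_sdecConvClosedTB`) and lead g28's `…QuantSingleGateClosure`.

THE POINT (lead g42, LEAD-NOTES-G42 N1; found independently and simultaneously by prim-quant-arm-1 g45, whose `…QuantGateCouplingMixture`
✓ p392674 states the same "environment + gated increment" reading in its header and PROVES the step for small outer gates, see below).  The
structural induction of record (`treeBuilt_sdec`, `treeBuilt_sdec_TB`) consumes the conv step in the form "`SDEC μ₁ ∧ SDEC μ₂ ⟹ SDEC (μ₁ ∗ μ₂)`"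
for two arbitrary (tree-built) factors — the node `SDECConvClosedTB`, equivalently the single-gate closure `SingleGateConvClosed` / `SGCGiantStep`,
open on regime R (V388/V391).  Re-organising the SAME induction as an induction on the number of vertices of the forest (carry "`μ` is a good
RIGHT factor": `SDECRightFactor`) shows that the conv step is only ever needed when the second factor is a SINGLE TREE with a proper root
gate, `μ₂ = gate c g` (`0 < g < 1`, `c` = the count law of the sub-forest under the root, tree-built at floor `x/g`), and that at that moment
the induction ALREADY KNOWS that `μ₁ ∗ c` — the forest with the root gate contracted — is SDEC at floor `x` (it has one vertex less).  This file
makes that reading a KERNEL REDUCTION (`treeBuilt_rightFactor`, `farTreeRow_of_rootGateStep`); arm-1 g45's theorems `decAt_gateCoupling_B(_light)`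
(✓ p392674) PROVE the node's conclusion for every outer gate `q′ ≤ T₁/(T₁ + g·T_c)` when the sub-forest's floor is at most the forest's (an explicit
two-component re-gating mixture of `gate_{a⋆}(μ₁ ∗ c)` and `gate_{a₀} μ₁` at the common target), and their memo ARCH-LIGHT-G45 §3 shows that with a
BLACK-BOX first factor the mixture route has an exact floor deficit for larger outer gates (the true certificate re-routes across the two pieces) —
so the node below is a valid and strictly weaker replacement of `SDECConvClosedTB`, but NOT expected to fall to re-gating mixtures alone; arm-1's
two-root identity (⧗ p392934 `…QuantTwoRootGateCoupling`: `gate_a(t₁ ∗ t₂)` is an exact two-term mixture when BOTH root gates are re-tuned) is the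
model of what does.  Hence the node of this file:

* **`LawDec.RootGateStep`** (`@[conjecture]`): floor `0 < x < g < 1`; `μ₁` a top-affordable probability law on `{0..M₁}` SDEC at `x`; `c` a
  top-affordable probability law on `{0..M₂}` SDEC at `x/g`; and `lconv M₁ M₂ μ₁ c` SDEC at `x`.  THEN `lconv M₁ M₂ μ₁ (gate c g)` is SDEC at `x`.
  In random variables: `N = N₁ + η·N_c` with `η ~ Bernoulli(g)` independent; the hypotheses are the gate-stable DEC of `ξN₁`, of `ξ′N_c` and of
  `ξ(N₁ + N_c)`; the conclusion is that of `ξ(N₁ + ηN_c)`.  As laws (arm-1 g45's `lconv_gate_right`, ✓ p392674):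
  `μ₁ ∗ gate_g c = (1 − g)·μ₁ + g·(μ₁ ∗ c)` — a TWO-PIECE MIXTURE of a law and its `c`-convolution, both SDEC, to be certified at the
  INTERPOLATED target `T₁ + g·T_c` (the `g = 0` and `g = 1` ends are the hypotheses).  It is implied by `SDECConvClosed` and by
  `SingleGateConvClosed` (`rootGateStep_of_sdecConvClosed`, `rootGateStep_of_singleGate`: drop the third hypothesis), so all exact evidence
  for SGC (census-2 g62–g69: 0 violations in ≈ 2.5·10⁸ optimiser LPs) is evidence for it; it is WEAKER than both because of the extra
  hypothesis `SDEC x (μ₁ ∗ c)`, which no law-level node of the lane had before (GateMove's extra datum is `DEC (gate_q μ₁ ∗ μ₂)`, a different law).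
  Known cells: `c = δ₁` / `c = δ_K` (the tree is a relay / a block: `sdec_slice_relay`, CW = `WindowMixDEC` ✓ p373052); by V388/V391 only the
  layers of regime R of `gate_q(μ₁ ∗ gate_g c)` are open.
* `LawDec.SDECRightFactor x M μ` — "`μ` is a good right factor down to every floor `x′ ≤ x`": for every top-affordable probability law `μ₁`
  SDEC at `x′`, `lconv M₁ M μ₁ μ` is SDEC at `x′`.
* **`LawDec.treeBuilt_rightFactor`**: `RootGateStep →` every `TreeBuilt x M μ` is a top-affordable probability law, SDEC at `x`, AND a good
  right factor.  Induction on the derivation: `nil` (`lconv_delta_right`), `relay` (`sdec_slice_relay` with the sure gate), `conv` (associativity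
  `lconv_assoc`: `μ₁ ∗ (a ∗ b) = (μ₁ ∗ a) ∗ b`, right factors compose), `gate` with `g = 1` (`gate_one`), `gate` with `g < 1` (THE NODE, fed with
  `SDEC x′ (μ₁ ∗ c)` from the induction hypothesis "`c` is a good right factor"), `mono`.
* **`LawDec.sdecConvClosedTB_of_rootGateStep : RootGateStep → SDECConvClosedTB`**, `treeBuiltDEC_of_rootGateStep`,
  **`Quant.farTreeRow_of_rootGateStep : LawDec.RootGateStep → FarTreeRow`**.
* bookkeeping: `lconv_assoc` (associativity of `lconv` with the top indices, no hypotheses; arm-1's `lconv_gate_right` is the mixture identity),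
  `lconv_relay_right` (`μ ∗ δ₁ = slice μ 1 1`); `rootGateStep_mixture` (the node read on the mixture `(1−g)·μ₁ + g·(μ₁ ∗ c)`).

REMARKS FOR PROVERS.  (1) The node is needed for ONE root per forest only (any root may be contracted), and only for `g < 1`; a proof may
therefore also assume anything that holds for SOME root of every forest with ≥ 2 trees — not expressible at law level, recorded here.
(2) `q = 1` of the conclusion is `ConvClosedT` (✓ `convClosedT_holds`, census-2 g60) applied to `μ₁` and `gate c g`; the content is `q < 1`.
(3) The two-piece transport: `gate_q(μ₁ ∗ c)` is DEC at target `q(T₁ + T_c) > S := q(T₁ + gT_c)`, hence at `S` with its lows in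
`[S/2, q(T₁+T_c)/2)` freed (`decAtT_antitone_target`); `gate_q μ₁` is DEC at `qT₁ < S` and is deficient at `S` exactly by its atoms in
`[qT₁/2, S/2)` and by its credit pairs `{l, h}` with `l + h ≤ S`; the node asks the freed capacity of the heavier piece (weight `g`, surplus
`(1−g)·qT_c` of target) to pay for the deficiency of the lighter piece (weight `1−g`, shortfall `g·qT_c`) — first moments balance exactly.

HONEST STATUS: `RootGateStep` is OPEN (a conjecture with the evidence of SGC); `FarTreeRow`, `SDECConvClosedTB`, `SingleGateConvClosed` stay OPEN;
the RATE class log\* and the honest sentence of `run/shared/lean/prim/quant/README.md` are unchanged.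

[this work]; SDEC / TreeBuilt: prim-quant-census-2 g53; `SDECConvClosedTB`: prim-quant-stmt g31; SGC: prim-quant-lead g28; relay slice:
prim-quant-stmt g27 (this lane).  Nothing here is cited as a published result.  The gluing rows served
[cite: KozmaNitzan2024, Conjecture 3 (p. 15)]; product measure [cite: Grimmett1999, §1.3 p. 10].
-/

noncomputable section

namespace Summit.CriticalPhenomena.PercolationContinuityZ3.Theorems

namespace Quant

open Finset

namespace LawDec

/-! ### Bookkeeping: associativity of `lconv`, the mixture identity, the relay as a slice -/

/-- the triple-sum form of `μ₁ ∗ (μ₂ ∗ μ₃)`. [this work] -/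
theorem lconv_lconv_right_apply (M₁ M₂ M₃ : ℕ) (μ₁ μ₂ μ₃ : ℕ → ℝ) (h : ℕ) :
    lconv M₁ (M₂ + M₃) μ₁ (lconv M₂ M₃ μ₂ μ₃) h
      = ∑ i ∈ Finset.range (M₁ + 1), ∑ a ∈ Finset.range (M₂ + 1), ∑ b ∈ Finset.range (M₃ + 1),
          (if i + a + b = h then μ₁ i * μ₂ a * μ₃ b else 0) := by
  simp only [lconv]
  refine Finset.sum_congr rfl fun i _ => ?_
  -- push the outer indicator inside the double sum defining `lconv μ₂ μ₃`
  have e1 : ∀ s : ℕ, (if i + s = h then μ₁ i * ∑ a ∈ Finset.range (M₂ + 1), ∑ b ∈ Finset.range (M₃ + 1),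
        (if a + b = s then μ₂ a * μ₃ b else 0) else 0)
      = ∑ a ∈ Finset.range (M₂ + 1), ∑ b ∈ Finset.range (M₃ + 1),
          (if a + b = s then (if i + s = h then μ₁ i * μ₂ a * μ₃ b else 0) else 0) := by
    intro s
    by_cases his : i + s = h
    · rw [if_pos his, Finset.mul_sum]
      refine Finset.sum_congr rfl fun a _ => ?_
      rw [Finset.mul_sum]
      refine Finset.sum_congr rfl fun b _ => ?_
      by_cases hab : a + b = s
      · rw [if_pos hab, if_pos hab, if_pos his, mul_assoc]
      · rw [if_neg hab, if_neg hab, mul_zero]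
    · rw [if_neg his]
      symm
      refine Finset.sum_eq_zero fun a _ => Finset.sum_eq_zero fun b _ => ?_
      by_cases hab : a + b = s
      · rw [if_pos hab, if_neg his]
      · rw [if_neg hab]
  simp_rw [e1]
  rw [Finset.sum_comm]
  refine Finset.sum_congr rfl fun a ha => ?_
  rw [Finset.sum_comm]
  refine Finset.sum_congr rfl fun b hb => ?_
  rw [Finset.sum_ite_eq (Finset.range (M₂ + M₃ + 1)) (a + b)]
  have hmem : a + b ∈ Finset.range (M₂ + M₃ + 1) := by
    rw [Finset.mem_range] at ha hb ⊢; omega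
  rw [if_pos hmem]
  by_cases hh : i + a + b = h
  · rw [if_pos hh, if_pos (by omega)]
  · rw [if_neg hh, if_neg (by omega)]

/-- the triple-sum form of `(μ₁ ∗ μ₂) ∗ μ₃`. [this work] -/
theorem lconv_lconv_left_apply (M₁ M₂ M₃ : ℕ) (μ₁ μ₂ μ₃ : ℕ → ℝ) (h : ℕ) :
    lconv (M₁ + M₂) M₃ (lconv M₁ M₂ μ₁ μ₂) μ₃ h
      = ∑ i ∈ Finset.range (M₁ + 1), ∑ a ∈ Finset.range (M₂ + 1), ∑ b ∈ Finset.range (M₃ + 1),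
          (if i + a + b = h then μ₁ i * μ₂ a * μ₃ b else 0) := by
  simp only [lconv]
  -- push the outer indicator inside the double sum defining `lconv μ₁ μ₂`
  have e1 : ∀ t b : ℕ, (if t + b = h then (∑ i ∈ Finset.range (M₁ + 1), ∑ a ∈ Finset.range (M₂ + 1),
        (if i + a = t then μ₁ i * μ₂ a else 0)) * μ₃ b else 0)
      = ∑ i ∈ Finset.range (M₁ + 1), ∑ a ∈ Finset.range (M₂ + 1),
          (if i + a = t then (if t + b = h then μ₁ i * μ₂ a * μ₃ b else 0) else 0) := by
    intro t b
    by_cases htb : t + b = h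
    · rw [if_pos htb, Finset.sum_mul]
      refine Finset.sum_congr rfl fun i _ => ?_
      rw [Finset.sum_mul]
      refine Finset.sum_congr rfl fun a _ => ?_
      by_cases hia : i + a = t
      · rw [if_pos hia, if_pos hia, if_pos htb]
      · rw [if_neg hia, if_neg hia, zero_mul]
    · rw [if_neg htb]
      symm
      refine Finset.sum_eq_zero fun i _ => Finset.sum_eq_zero fun a _ => ?_
      by_cases hia : i + a = t
      · rw [if_pos hia, if_neg htb]
      · rw [if_neg hia]
  simp_rw [e1]
  -- reorder: `∑ t, ∑ b, ∑ i, ∑ a` ↦ `∑ i, ∑ a, ∑ b, ∑ t`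
  rw [Finset.sum_comm]
  have e2 : ∀ b : ℕ, ∑ t ∈ Finset.range (M₁ + M₂ + 1), ∑ i ∈ Finset.range (M₁ + 1), ∑ a ∈ Finset.range (M₂ + 1),
        (if i + a = t then (if t + b = h then μ₁ i * μ₂ a * μ₃ b else 0) else 0)
      = ∑ i ∈ Finset.range (M₁ + 1), ∑ a ∈ Finset.range (M₂ + 1),
          (if i + a + b = h then μ₁ i * μ₂ a * μ₃ b else 0) := by
    intro b
    rw [Finset.sum_comm]
    refine Finset.sum_congr rfl fun i hi => ?_
    rw [Finset.sum_comm]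
    refine Finset.sum_congr rfl fun a ha => ?_
    rw [Finset.sum_ite_eq (Finset.range (M₁ + M₂ + 1)) (i + a)]
    have hmem : i + a ∈ Finset.range (M₁ + M₂ + 1) := by
      rw [Finset.mem_range] at hi ha ⊢; omega
    rw [if_pos hmem]
  simp_rw [e2]
  rw [Finset.sum_comm]
  refine Finset.sum_congr rfl fun i _ => ?_
  rw [Finset.sum_comm]

/-- **`lconv` is associative** (with its top indices; no hypotheses on the laws):
`μ₁ ∗ (μ₂ ∗ μ₃) = (μ₁ ∗ μ₂) ∗ μ₃` on `{0..M₁} × {0..M₂} × {0..M₃}`. [this work] -/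
theorem lconv_assoc (M₁ M₂ M₃ : ℕ) (μ₁ μ₂ μ₃ : ℕ → ℝ) :
    lconv M₁ (M₂ + M₃) μ₁ (lconv M₂ M₃ μ₂ μ₃) = lconv (M₁ + M₂) M₃ (lconv M₁ M₂ μ₁ μ₂) μ₃ := by
  funext h
  rw [lconv_lconv_right_apply, lconv_lconv_left_apply]

/-- **a sure relay beside `μ`**: `μ ∗ δ₁ = slice μ 1 1` (the shift by one), for `μ` vanishing above its top. [this work] -/
theorem lconv_relay_right (M : ℕ) (μ : ℕ → ℝ) (hμM : ∀ h, M < h → μ h = 0) :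
    lconv M 1 μ (fun k => if k = 1 then (1 : ℝ) else 0) = slice μ 1 1 := by
  have := lconv_gate_point_eq_slice M 1 μ 1 hμM
  rwa [gate_one] at this

/-! ### The node -/

/-- **CONJECTURE (THE ROOT-GATE STEP; lead g42).**  For a floor `0 < x`, a root gate `x < g < 1`, a top-affordable probability law `μ₁` on
`{0..M₁}` (nonnegative, vanishing above `M₁`, mass `1`, `x·M₁ ≤ mean`) that is SDEC at `x`, and a top-affordable probability law `c` on
`{0..M₂}` that is SDEC at the floor `x/g` (`(x/g)·M₂ ≤ mean c`): **if `lconv M₁ M₂ μ₁ c` is SDEC at `x`, then so is `lconv M₁ M₂ μ₁ (gate c g)`.**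
Tree reading: a forest (`μ₁`) beside one tree (root gate `g` over a sub-forest with count law `c`); the hypotheses are the gate-stable DEC of
the forest, of the sub-forest (at its own floor) and of "forest ⊔ sub-forest" (the root gate contracted — one vertex less); the conclusion is
that of "forest ⊔ tree".  As laws the conclusion concerns the two-piece mixture `(1−g)·μ₁ + g·(μ₁ ∗ c)` (`lconv_gate_right`) at the
interpolated mean `T₁ + g·T_c`.  Implied by `SDECConvClosed` / `SingleGateConvClosed` (`rootGateStep_of_sdecConvClosed`,
`rootGateStep_of_singleGate`); implies `SDECConvClosedTB`, `TreeBuiltDEC`, `Quant.FarTreeRow` (`treeBuilt_rightFactor`, this file).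
EVIDENCE: that of `SingleGateConvClosed` (census-2 g62–g69: 0 violations in ≈ 2.5·10⁸ exact/float optimiser LPs over the DEC hypothesis
polytope; equality only on the row / moment identities, README V389/V392).
builds on p205010 (kernel theorem, internal audit signed; external expert review pending). [this work] [status: open] -/
@[conjecture] def RootGateStep : Prop :=
  ∀ (x g : ℝ) (M₁ M₂ : ℕ) (μ₁ c : ℕ → ℝ),
    0 < x → x < g → g < 1 →
    (∀ h, 0 ≤ μ₁ h) → (∀ h, M₁ < h → μ₁ h = 0) → (∑ h ∈ Finset.range (M₁ + 1), μ₁ h = 1) →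
    x * (M₁ : ℝ) ≤ ∑ h ∈ Finset.range (M₁ + 1), (h : ℝ) * μ₁ h →
    (∀ h, 0 ≤ c h) → (∀ h, M₂ < h → c h = 0) → (∑ h ∈ Finset.range (M₂ + 1), c h = 1) →
    (x / g) * (M₂ : ℝ) ≤ ∑ h ∈ Finset.range (M₂ + 1), (h : ℝ) * c h →
    SDEC x M₁ μ₁ → SDEC (x / g) M₂ c → SDEC x (M₁ + M₂) (lconv M₁ M₂ μ₁ c) →
    SDEC x (M₁ + M₂) (lconv M₁ M₂ μ₁ (gate c g))

/-- **`SDECConvClosed ⟹ RootGateStep`** (drop the third hypothesis: `gate c g` is SDEC at `g·(x/g) = x`). [this work] -/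
theorem rootGateStep_of_sdecConvClosed (hC : SDECConvClosed) : RootGateStep := by
  intro x g M₁ M₂ μ₁ c hx0 hxg hg1 h10 h1M h11 hta1 hc0 hcM hc1 htac hS1 hSc _
  have hg0 : 0 < g := lt_trans hx0 hxg
  have hx1 : x < 1 := lt_trans hxg hg1
  have hgx : g * (x / g) = x := by field_simp
  -- law facts of `gate c g` at floor `x`
  have hg0' : ∀ h, 0 ≤ gate c g h := by
    intro h; simp only [LawDec.gate]; split_ifs <;> nlinarith [hc0 h]
  have hgM : ∀ h, M₂ < h → gate c g h = 0 := by
    intro h hh; simp only [LawDec.gate]; rw [hcM h hh, if_neg (by omega)]; ring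
  have hg1' : ∑ h ∈ Finset.range (M₂ + 1), gate c g h = 1 := sum_gate c g M₂ hc1
  have htag : x * (M₂ : ℝ) ≤ ∑ h ∈ Finset.range (M₂ + 1), (h : ℝ) * gate c g h := by
    rw [sum_mul_gate]
    have := mul_le_mul_of_nonneg_left htac hg0.le
    rw [← mul_assoc, hgx] at this
    exact this
  have hSg : SDEC x M₂ (gate c g) := by
    have := sdec_gate hSc g hg0 hg1.le
    rwa [hgx] at this
  exact hC x M₁ M₂ μ₁ (gate c g) hx0 hx1 h10 h1M h11 hta1 hg0' hgM hg1' htag hS1 hSg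

/-- **`SingleGateConvClosed ⟹ RootGateStep`** (through `SDECConvClosed`). [this work] -/
theorem rootGateStep_of_singleGate (hS : SingleGateConvClosed) : RootGateStep :=
  rootGateStep_of_sdecConvClosed (sdecConvClosed_of_singleGate hS)

/-- **the node in mixture form**: under `RootGateStep`, with the hypotheses of the node, the two-piece mixture
`h ↦ (1 − g)·μ₁ h + g·(μ₁ ∗ c) h` is SDEC at `x` on `{0..M₁+M₂}` (`lconv_gate_right`). [this work] -/
theorem rootGateStep_mixture (hR : RootGateStep) (x g : ℝ) (M₁ M₂ : ℕ) (μ₁ c : ℕ → ℝ)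
    (hx0 : 0 < x) (hxg : x < g) (hg1 : g < 1)
    (h10 : ∀ h, 0 ≤ μ₁ h) (h1M : ∀ h, M₁ < h → μ₁ h = 0) (h11 : ∑ h ∈ Finset.range (M₁ + 1), μ₁ h = 1)
    (hta1 : x * (M₁ : ℝ) ≤ ∑ h ∈ Finset.range (M₁ + 1), (h : ℝ) * μ₁ h)
    (hc0 : ∀ h, 0 ≤ c h) (hcM : ∀ h, M₂ < h → c h = 0) (hc1 : ∑ h ∈ Finset.range (M₂ + 1), c h = 1)
    (htac : (x / g) * (M₂ : ℝ) ≤ ∑ h ∈ Finset.range (M₂ + 1), (h : ℝ) * c h)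
    (hS1 : SDEC x M₁ μ₁) (hSc : SDEC (x / g) M₂ c) (hSconv : SDEC x (M₁ + M₂) (lconv M₁ M₂ μ₁ c)) :
    SDEC x (M₁ + M₂) (fun h => (1 - g) * μ₁ h + g * lconv M₁ M₂ μ₁ c h) := by
  have e : (fun h => (1 - g) * μ₁ h + g * lconv M₁ M₂ μ₁ c h) = lconv M₁ M₂ μ₁ (gate c g) :=
    funext fun h => by rw [lconv_gate_right M₁ M₂ μ₁ c g h1M h]; ring
  rw [e]
  exact hR x g M₁ M₂ μ₁ c hx0 hxg hg1 h10 h1M h11 hta1 hc0 hcM hc1 htac hS1 hSc hSconv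

/-! ### Good right factors and the structural induction -/

/-- **"`μ` (on `{0..M}`) is a good right factor down to every floor `x′ ≤ x`"**: convolving any top-affordable probability law that is SDEC at
`x′` with `μ` gives a law SDEC at `x′`. [this work] -/
def SDECRightFactor (x : ℝ) (M : ℕ) (μ : ℕ → ℝ) : Prop :=
  ∀ (x' : ℝ) (M₁ : ℕ) (μ₁ : ℕ → ℝ), 0 < x' → x' ≤ x →
    (∀ h, 0 ≤ μ₁ h) → (∀ h, M₁ < h → μ₁ h = 0) → (∑ h ∈ Finset.range (M₁ + 1), μ₁ h = 1) →
    x' * (M₁ : ℝ) ≤ (∑ h ∈ Finset.range (M₁ + 1), (h : ℝ) * μ₁ h) →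
    SDEC x' M₁ μ₁ → SDEC x' (M₁ + M) (lconv M₁ M μ₁ μ)

/-- **THE STRUCTURAL INDUCTION FROM THE ROOT-GATE STEP.**  Under `RootGateStep`, every tree-built law is a top-affordable probability law on
`{0..M}` at a floor in `(0,1)`, SDEC there, AND a good right factor (`SDECRightFactor`).  Cases: `nil` — `μ₁ ∗ δ₀ = μ₁`; `relay` —
`μ₁ ∗ δ₁ = slice μ₁ 1 1` is SDEC by the relay gate step `sdec_slice_relay` (sure gate); `conv` — SDEC of `a ∗ b` is "`b` is a good right
factor" applied to `a`, and `μ₁ ∗ (a ∗ b) = (μ₁ ∗ a) ∗ b` (`lconv_assoc`) makes right factors compose; `gate c g` — for `g = 1` nothing to do,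
for `g < 1` THE NODE, whose third hypothesis `SDEC x′ (μ₁ ∗ c)` is "`c` is a good right factor" applied to `μ₁`; `mono` — floors only drop.
[this work] -/
theorem treeBuilt_rightFactor (hR : RootGateStep) {x : ℝ} {M : ℕ} {μ : ℕ → ℝ} (h : TreeBuilt x M μ) :
    0 < x ∧ x < 1 ∧ (∀ k, 0 ≤ μ k) ∧ (∀ k, M < k → μ k = 0) ∧ (∑ k ∈ Finset.range (M + 1), μ k = 1) ∧
      x * (M : ℝ) ≤ (∑ k ∈ Finset.range (M + 1), (k : ℝ) * μ k) ∧ SDEC x M μ ∧ SDECRightFactor x M μ := by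
  induction h with
  | nil x₀ hx0 hx1 =>
    refine ⟨hx0, hx1, fun k => ?_, fun k hk => if_neg (by omega), by simp, by simp, ?_, ?_⟩
    · beta_reduce; split_ifs <;> norm_num
    · intro q _ _ j' hj; omega
    · intro x' M₁ μ₁ _ _ _ h1M _ _ hS1
      have e : lconv M₁ 0 μ₁ (fun h => if h = 0 then (1 : ℝ) else 0) = μ₁ :=
        funext fun h => lconv_delta_right M₁ 0 μ₁ h1M h
      rw [e]
      exact hS1
  | relay x₀ hx0 hx1 =>
    refine ⟨hx0, hx1, fun k => ?_, fun k hk => if_neg (by omega), by simp, by simp; linarith, sdec_relay x₀ hx0 hx1.le, ?_⟩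
    · beta_reduce; split_ifs <;> norm_num
    · intro x' M₁ μ₁ hx'0 hx'x h10 h1M h11 hta1 hS1
      rw [lconv_relay_right M₁ μ₁ h1M]
      exact sdec_slice_relay x' 1 M₁ μ₁ hx'0 (lt_of_le_of_lt hx'x hx1) (by linarith [lt_of_le_of_lt hx'x hx1]) le_rfl
        h10 h1M h11 hta1 hS1
  | @conv x₀ Ma Mb a b ha hb iha ihb =>
    obtain ⟨hx0, hx1, n1, z1, s1, t1, d1, r1⟩ := iha
    obtain ⟨_, _, n2, z2, s2, t2, _, r2⟩ := ihb
    refine ⟨hx0, hx1, lconv_nonneg _ _ _ _ n1 n2, fun k hk => lconv_eq_zero _ _ _ _ k hk, sum_lconv _ _ _ _ s1 s2, ?_,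
      r2 x₀ Ma a hx0 le_rfl n1 z1 s1 t1 d1, ?_⟩
    · rw [sum_mul_lconv _ _ _ _ s1 s2, Nat.cast_add]
      linarith
    · intro x' M₁ μ₁ hx'0 hx'x h10 h1M h11 hta1 hS1
      -- `μ₁ ∗ (a ∗ b) = (μ₁ ∗ a) ∗ b`
      rw [show M₁ + (Ma + Mb) = (M₁ + Ma) + Mb from (Nat.add_assoc _ _ _).symm, lconv_assoc]
      have hA : SDEC x' (M₁ + Ma) (lconv M₁ Ma μ₁ a) := r1 x' M₁ μ₁ hx'0 hx'x h10 h1M h11 hta1 hS1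
      refine r2 x' (M₁ + Ma) (lconv M₁ Ma μ₁ a) hx'0 hx'x (lconv_nonneg _ _ _ _ h10 n1)
        (fun k hk => lconv_eq_zero _ _ _ _ k hk) (sum_lconv _ _ _ _ h11 s1) ?_ hA
      rw [sum_mul_lconv _ _ _ _ h11 s1, Nat.cast_add]
      have : x' * (Ma : ℝ) ≤ x₀ * (Ma : ℝ) := mul_le_mul_of_nonneg_right hx'x (Nat.cast_nonneg _)
      linarith
  | @gate x₀ M₀ c g hg0 hg1 h ih =>
    obtain ⟨hx0, hx1, n1, z1, s1, t1, d1, r1⟩ := ih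
    refine ⟨mul_pos hg0 hx0, by nlinarith, fun k => ?_, fun k hk => ?_, sum_gate _ g _ s1, ?_, sdec_gate d1 g hg0 hg1, ?_⟩
    · simp only [LawDec.gate]; split_ifs <;> nlinarith [n1 k]
    · simp only [LawDec.gate]; rw [z1 k hk, if_neg (by omega)]; ring
    · rw [sum_mul_gate]; nlinarith
    · intro x' M₁ μ₁ hx'0 hx'x h10 h1M h11 hta1 hS1
      rcases eq_or_lt_of_le hg1 with hg | hg
      · -- a sure root gate: the tree IS its sub-forest
        subst hg
        rw [gate_one]
        rw [one_mul] at hx'x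
        exact r1 x' M₁ μ₁ hx'0 hx'x h10 h1M h11 hta1 hS1
      · -- a proper root gate: THE NODE at floor `x′`, sub-forest at floor `x′/g ≤ x₀`
        have hx'g : x' / g ≤ x₀ := by
          rw [div_le_iff₀ hg0]; linarith [mul_comm g x₀]
        have hx'g0 : 0 < x' / g := div_pos hx'0 hg0
        have hxg : x' < g := by
          have : g * x₀ < g * 1 := mul_lt_mul_of_pos_left hx1 hg0
          linarith
        have htac : (x' / g) * (M₀ : ℝ) ≤ ∑ k ∈ Finset.range (M₀ + 1), (k : ℝ) * c k := by
          have : (x' / g) * (M₀ : ℝ) ≤ x₀ * (M₀ : ℝ) := mul_le_mul_of_nonneg_right hx'g (Nat.cast_nonneg _)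
          linarith
        have hSc : SDEC (x' / g) M₀ c := sdec_mono d1 hx'g hx1
        have hconv : SDEC x' (M₁ + M₀) (lconv M₁ M₀ μ₁ c) :=
          r1 x' M₁ μ₁ hx'0 (le_trans hx'x (by nlinarith)) h10 h1M h11 hta1 hS1
        exact hR x' g M₁ M₀ μ₁ c hx'0 hxg hg h10 h1M h11 hta1 n1 z1 s1 htac hS1 hSc hconv
  | @mono x₀ x'' M₀ μ₀ h hx''0 hxx ih =>
    obtain ⟨hx0, hx1, n1, z1, s1, t1, d1, r1⟩ := ih
    refine ⟨hx''0, lt_of_le_of_lt hxx hx1, n1, z1, s1, ?_, sdec_mono d1 hxx hx1, ?_⟩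
    · have : x'' * (M₀ : ℝ) ≤ x₀ * (M₀ : ℝ) := mul_le_mul_of_nonneg_right hxx (Nat.cast_nonneg _)
      linarith
    · intro x' M₁ μ₁ hx'0 hx'x h10 h1M h11 hta1 hS1
      exact r1 x' M₁ μ₁ hx'0 (le_trans hx'x hxx) h10 h1M h11 hta1 hS1

/-- **`RootGateStep ⟹ SDECConvClosedTB`**: the second factor is tree-built, hence a good right factor. [this work] -/
theorem sdecConvClosedTB_of_rootGateStep (hR : RootGateStep) : SDECConvClosedTB := by
  intro x M₁ M₂ μ₁ μ₂ h₁ h₂ s₁ _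
  obtain ⟨hx0, _, n1, z1, m1, t1, _, _⟩ := treeBuilt_rightFactor hR h₁
  obtain ⟨_, _, _, _, _, _, _, r2⟩ := treeBuilt_rightFactor hR h₂
  exact r2 x M₁ μ₁ hx0 le_rfl n1 z1 m1 t1 s₁

/-- **`RootGateStep ⟹ TreeBuiltDEC`** (every tree-built count law is DEC at every layer). [this work] -/
theorem treeBuiltDEC_of_rootGateStep (hR : RootGateStep) : TreeBuiltDEC :=
  treeBuiltDEC_of_sdecConvClosedTB (sdecConvClosedTB_of_rootGateStep hR)

end LawDec

/-- **`RootGateStep ⟹ Quant.FarTreeRow`** — the R8 tree row follows from the root-gate step alone. [this work] -/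
theorem farTreeRow_of_rootGateStep (hR : LawDec.RootGateStep) : FarTreeRow :=
  farTreeRow_of_sdecConvClosedTB (LawDec.sdecConvClosedTB_of_rootGateStep hR)

end Quant

end Summit.CriticalPhenomena.PercolationContinuityZ3.Theorems
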